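import Literature.AlgebraicGeometry.Resolution.DerivativeIdealsBlowup
import Literature.AlgebraicGeometry.Resolution.MarkedIdealsLemmas
import Literature.AlgebraicGeometry.Resolution.DerivativeIdealsSupport
import Mathlib.RingTheory.Etale.Kaehler
import Mathlib.AlgebraicGeometry.Morphisms.Etale
import HarnessLib

/-!
# Derivative ideals grow under étale pull-back: `ψ^*𝒟ⁱ(𝓘) ⊆ 𝒟ⁱ(ψ^*𝓘)` (Kollár 2007, 3.74.5 / Def. 3.91 (4′))

Topic: `Literature/AlgebraicGeometry/Resolution`. Small algebra on the line discharging the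
named fact `Kollar2007Thm3_103` (`KollarBlowupSequenceFunctors.lean`; J. Kollár, *Lectures on
Resolution of Singularities*, 2007) through 3.104 Step 2.3: Kollár's étale equivalence
(Def. 3.91 (4′) / Def. 3.96 (2)) compares `ψ^*(h) - ψ'^*(h)` with the maximal contact ideal
`MC(ψ^*(I)) = 𝒟^{m-1}(ψ^* I)` computed ON THE ÉTALE COVER `U`, whereas Thm. 3.92 is proved with
the pull-back `ψ^*MC(I)` of the maximal contact ideal of `X` (`KollarEtaleNeighbourhood.lean`);
the two are reconciled by "taking derivatives commutes with [étale localization]" (cf. 3.74.5: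
"taking derivatives commutes with completion"). This file PROVES the inclusion that is needed:

* `exists_derivation_extend_of_formallyEtale'` — a `k`-derivation of `A` extends to a
  `k`-derivation of a formally étale `A`-algebra `B` (`Ω[B⁄k] = B ⊗_A Ω[A⁄k]`, Mathlib
  `KaehlerDifferential.isBaseChange_of_formallyEtale`; the same argument as the module-valued
  `Literature.NumberTheory.Transcendental.exists_derivation_extend_of_formallyEtale`, restated
  here to keep the import closure inside the topic);
* `map_derivIdeal_le_of_formallyEtale`, `map_derivIdealIter_le_of_formallyEtale` —
  **`𝒟ⁱ(I)·B ⊆ 𝒟ⁱ(I·B)`** for `B` formally étale over `A` (ring level, `derivIdealIter` of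
  `DerivativeIdeals.lean`);
* **`comap_derivIdealSheafIter_le_of_etale`** — for an étale morphism `ψ : U → X` of schemes
  with `k`-structures `φ` and `ψ^* ∘ φ` (finitely presented differentials on both):
  `ψ^*𝒟ⁱ_X(𝓘) ⊆ 𝒟ⁱ_U(ψ^*𝓘)` (`derivIdealSheafIter`, `DerivativeIdealSheaf.lean`), checked on
  affine opens `W ⊆ ψ⁻¹V`, where `Γ(X, V) → Γ(U, W)` is étale (Mathlib
  `HasRingHomProperty @Etale RingHom.Etale`) and a `k`-algebra map (`appLE_comp_sectionsHom`,
  `DerivativeIdealsBlowup.lean`).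

No definitions, no named fact. (The reverse inclusion also holds for étale `ψ` but is not
needed here.)

Second part (BGMW 2011, Lemma 3.9.5 (1): "Let `φ : X' → X` be an étale morphism of smooth
varieties … Then `φ^*(𝒟(𝓘)) = 𝒟(φ^*(𝓘))`", the input to functoriality 3.34.1 of the
constructions 3.102 / 3.104 along smooth morphisms of relative dimension `0`, along which
`MC(I)`, `W_s(I)`, `𝒞(I, m)` must be transported) — the REVERSE inclusion and the equality,
PROVED:

* `derivIdeal_map_le_map_derivIdeal` — for a `k`-algebra `A` whose module of differentials
  `Ω[A⁄k]` is finitely generated projective (a smooth affine variety) and ANY `k`-algebra map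
  `f : A → B`: `𝒟(I·B) ⊆ 𝒟(I)·B` — a `k`-derivation `δ'` of `B` restricts to a derivation
  `A → B`, i.e. an `A`-linear map `Ω[A⁄k] → B`, which factors through a finite free module of
  which `Ω[A⁄k]` is a direct summand: `δ'(f(a)) = Σ_j b_j f(δ_j a)` for derivations `δ_j` of `A`;
* `derivIdealIter_map_of_formallyEtale` — hence `𝒟ⁱ(I·B) = 𝒟ⁱ(I)·B` for `B` formally étale
  over such an `A`;
* **`derivIdealSheafIter_comap_of_etale`** — `ψ^*𝒟ⁱ(𝓘) = 𝒟ⁱ(ψ^*𝓘)` for étale `ψ` when moreover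
  the affine pieces of `X` have projective differentials (e.g. `X` smooth over the field `k`:
  `projective_kaehlerDifferential_sections_of_smooth`, `derivIdealSheafIter_comap_of_etale_of_smooth`).
  The marked forms (Lemma 3.9.5 (3): `ψ^*𝒞(𝓘, μ) = 𝒞(ψ^*𝓘, μ)`, `ψ^*MC(I) = MC(ψ^*I)`,
  `ψ^*W_s(I) = W_s(ψ^*I)`) are one rewrite away and left to the users.

## Sources

* J. Kollár, *Lectures on Resolution of Singularities* (2007): 3.74.5 (p. 153), Def. 3.91 (4′)
  (p. 162), Def. 3.96 (2) (p. 165) of the held copy. [Kollar2007]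
* E. Bierstone, D. Grigoriev, P. Milman, J. Włodarczyk, arXiv:1206.3090, Def. 3.5.1 (the sheaves
  `𝒟ⁱ(𝓘)`), Lemma 3.9.5 (1) (p. 10), Lemma 8.0.3 (2) ("étale morphisms preserve …").
  [BierstoneGrigorievMilmanWlodarczyk2011]
* The Stacks Project, Tag 031J (differentials of formally étale algebras). [StacksProject]
-/

noncomputable section

open CategoryTheory AlgebraicGeometry TopologicalSpace TensorProduct

namespace Literature.AlgebraicGeometry.Resolution

universe u v

/-! ## Ring level: derivations extend along formally étale algebras -/

section RingLevel

variable (k : Type*) [CommRing k] {A B : Type*} [CommRing A] [CommRing B] [Algebra k A]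
  [Algebra k B] [Algebra A B] [IsScalarTower k A B]

/-- **Derivations extend along formally étale algebras**: for `B` formally étale over `A` and a
`k`-derivation `δ` of `A` there is a `k`-derivation `δ'` of `B` with `δ'(a) = δ(a)` on `A`
(`Ω[B⁄k] = B ⊗_A Ω[A⁄k]`). [folklore] -/
theorem exists_derivation_extend_of_formallyEtale' [Algebra.FormallyEtale A B]
    (δ : Derivation k A A) :
    ∃ δ' : Derivation k B B, ∀ a : A, δ' (algebraMap A B a) = algebraMap A B (δ a) := by
  have h := KaehlerDifferential.isBaseChange_of_formallyEtale k A B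
  let D : Derivation k A B := (Algebra.linearMap A B).compDer δ
  let ℓ : Ω[B⁄k] →ₗ[B] B := h.lift D.liftKaehlerDifferential
  refine ⟨ℓ.compDer (KaehlerDifferential.D k B), fun a => ?_⟩
  change ℓ (KaehlerDifferential.D k B (algebraMap A B a)) = _
  rw [← KaehlerDifferential.map_D k k A B a]
  change h.lift D.liftKaehlerDifferential (KaehlerDifferential.map k k A B _) = _
  rw [IsBaseChange.lift_eq, Derivation.liftKaehlerDifferential_comp_D]
  rfl

/-- **`𝒟(I)·B ⊆ 𝒟(I·B)`** for `B` formally étale over `A`.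
[cite: BierstoneGrigorievMilmanWlodarczyk2011, Def. 3.5.1] -/
theorem map_derivIdeal_le_of_formallyEtale [Algebra.FormallyEtale A B] (I : Ideal A) :
    (derivIdeal k I).map (algebraMap A B) ≤ derivIdeal k (I.map (algebraMap A B)) := by
  rw [Ideal.map_le_iff_le_comap, derivIdeal_le_iff]
  refine ⟨fun f hf => ?_, fun δ f hf => ?_⟩
  · exact Ideal.mem_comap.mpr ((le_derivIdeal k _) (Ideal.mem_map_of_mem _ hf))
  · obtain ⟨δ', hδ'⟩ := exists_derivation_extend_of_formallyEtale' k (B := B) δ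
    rw [Ideal.mem_comap, ← hδ']
    exact apply_mem_derivIdeal k δ' (Ideal.mem_map_of_mem _ hf)

/-- **`𝒟ⁱ(I)·B ⊆ 𝒟ⁱ(I·B)`** for `B` formally étale over `A`.
[cite: BierstoneGrigorievMilmanWlodarczyk2011, Def. 3.5.1] -/
theorem map_derivIdealIter_le_of_formallyEtale [Algebra.FormallyEtale A B] (i : ℕ) (I : Ideal A) :
    (derivIdealIter k i I).map (algebraMap A B) ≤ derivIdealIter k i (I.map (algebraMap A B)) := by
  induction i with
  | zero => exact le_rfl
  | succ i ih =>
    rw [derivIdealIter_succ, derivIdealIter_succ]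
    exact (map_derivIdeal_le_of_formallyEtale k _).trans (derivIdeal_mono k ih)

end RingLevel

/-! ## Sheaf level: `ψ^*𝒟ⁱ(𝓘) ⊆ 𝒟ⁱ(ψ^*𝓘)` for étale `ψ` -/

section SheafLevel

variable {k : Type v} [CommRing k] {U X : Scheme.{u}} (ψ : U ⟶ X) (φ : k →+* Γ(X, ⊤))

/-- **Derivative ideal sheaves grow under étale pull-back**: `ψ^*𝒟ⁱ_X(𝓘) ⊆ 𝒟ⁱ_U(ψ^*𝓘)` for an
étale `ψ : U → X` and the induced `k`-structure on `U` (finitely presented differentials on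
`X` and `U`). [cite: Kollar2007, 3.74.5 (p. 153) and Def. 3.91 (4′) (p. 162)] -/
theorem comap_derivIdealSheafIter_le_of_etale [Etale ψ] (hX : HasFinitePresentationDifferentials φ)
    (hU : HasFinitePresentationDifferentials (ψ.appTop.hom.comp φ)) (i : ℕ) (I : X.IdealSheafData) :
    (derivIdealSheafIter φ i I).comap ψ ≤ derivIdealSheafIter (ψ.appTop.hom.comp φ) i (I.comap ψ) := by
  refine le_of_forall_stalkIdeal_le fun x => ?_
  obtain ⟨V, hV, hxV, -⟩ :=
    exists_isAffineOpen_mem_and_subset (X := X) (x := ψ x) (U := ⊤) (Opens.mem_top _)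
  obtain ⟨W, hW, hxW, hWV⟩ :=
    exists_isAffineOpen_mem_and_subset (X := U) (x := x) (U := ψ ⁻¹ᵁ V) hxV
  let V' : X.affineOpens := ⟨V, hV⟩
  let W' : U.affineOpens := ⟨W, hW⟩
  have e : (W' : U.Opens) ≤ ψ ⁻¹ᵁ (V' : X.Opens) := hWV
  rw [stalkIdeal_eq_map_germ _ W' hxW, stalkIdeal_eq_map_germ _ W' hxW]
  refine Ideal.map_mono ?_
  rw [ideal_comap_of_le ψ _ V' W' e, derivIdealSheafIter_ideal hX, derivIdealSheafIter_ideal hU,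
    ideal_comap_of_le ψ I V' W' e]
  letI := sectionsAlgebra φ V'.1
  letI := sectionsAlgebra (ψ.appTop.hom.comp φ) W'.1
  letI alg : Algebra Γ(X, V'.1) Γ(U, W'.1) := (ψ.appLE V' W' e).hom.toAlgebra
  haveI : IsScalarTower k Γ(X, V'.1) Γ(U, W'.1) :=
    IsScalarTower.of_algebraMap_eq' (appLE_comp_sectionsHom φ ψ V' W' e).symm
  haveI : Algebra.Etale Γ(X, V'.1) Γ(U, W'.1) :=
    HasRingHomProperty.appLE @Etale ψ inferInstance V' W' e
  exact map_derivIdealIter_le_of_formallyEtale k i (I.ideal V')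

end SheafLevel

/-! ## Ring level, reverse inclusion: `𝒟(I·B) ⊆ 𝒟(I)·B` for projective differentials -/

section Reverse

variable {k : Type*} {A B : Type*} [CommRing k] [CommRing A] [CommRing B] [Algebra k A] [Algebra k B]

/-- **`𝒟(I·B) ⊆ 𝒟(I)·B` for any `k`-algebra map `f : A → B` when `Ω[A⁄k]` is finitely
generated projective**: a `k`-derivation of `B` restricted to `A` is an `A`-linear map
`Ω[A⁄k] → B`, and such maps are `B`-combinations of maps `Ω[A⁄k] → A` (`Ω[A⁄k]` is a direct
summand of a finite free module), i.e. of derivations of `A`.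
[cite: BierstoneGrigorievMilmanWlodarczyk2011, Lemma 3.9.5 (1)] -/
theorem derivIdeal_map_le_map_derivIdeal [Module.Projective A Ω[A⁄k]] [Module.Finite A Ω[A⁄k]]
    (f : A →ₐ[k] B) (I : Ideal A) :
    derivIdeal k (I.map f) ≤ (derivIdeal k I).map f := by
  classical
  letI alg : Algebra A B := f.toRingHom.toAlgebra
  haveI : IsScalarTower k A B := IsScalarTower.of_algebraMap_eq fun c => (f.commutes c).symm
  have hf : (algebraMap A B : A → B) = f := rfl
  -- a presentation of `Ω[A⁄k]` as a direct summand of a finite free module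
  obtain ⟨n, gen, hgen⟩ := Module.Finite.exists_fin (R := A) (M := Ω[A⁄k])
  set p : (Fin n → A) →ₗ[A] Ω[A⁄k] := Fintype.linearCombination A gen with hpdef
  have hp : Function.Surjective p := by
    rw [← LinearMap.range_eq_top, hpdef, Fintype.range_linearCombination, hgen]
  obtain ⟨s, hs⟩ := Module.projective_lifting_property p LinearMap.id hp
  -- the derivations `δ_j = (e_j^* ∘ s) ∘ d`
  let δ : Fin n → Derivation k A A := fun j =>
    ((LinearMap.proj j).comp s).compDer (KaehlerDifferential.D k A)
  -- key: `δ'(f a) = Σ_j f(δ_j a) · b_j`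
  have key : ∀ (δ' : Derivation k B B) (a : A), a ∈ I → δ' (f a) ∈ (derivIdeal k I).map f := by
    intro δ' a ha
    let D : Derivation k A B := δ'.compAlgebraMap A
    have hD : D a = δ' (f a) := rfl
    set lam : Ω[A⁄k] →ₗ[A] B := D.liftKaehlerDifferential with hlam
    have h1 : δ' (f a) = lam (KaehlerDifferential.D k A a) := by
      rw [← hD, hlam, Derivation.liftKaehlerDifferential_comp_D]
    have h2 : ∀ ω : Ω[A⁄k], lam ω = ∑ j, f (s ω j) * lam (gen j) := by
      intro ω
      have hω : ω = p (s ω) := by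
        change ω = (p.comp s) ω
        rw [hs, LinearMap.id_apply]
      conv_lhs => rw [hω]
      rw [hpdef, Fintype.linearCombination_apply, map_sum]
      refine Finset.sum_congr rfl fun j _ => ?_
      rw [LinearMap.map_smul, Algebra.smul_def, hf]
    rw [h1, h2]
    refine Ideal.sum_mem _ fun j _ => Ideal.mul_mem_right _ _ (Ideal.mem_map_of_mem f ?_)
    have : s (KaehlerDifferential.D k A a) j = δ j a := rfl
    rw [this]
    exact apply_mem_derivIdeal k (δ j) ha
  rw [derivIdeal_le_iff]
  refine ⟨Ideal.map_mono (le_derivIdeal k I), fun δ' x hx => ?_⟩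
  refine Submodule.span_induction (p := fun x _ => δ' x ∈ (derivIdeal k I).map f) ?_ ?_ ?_ ?_ hx
  · rintro _ ⟨a, ha, rfl⟩
    exact key δ' a ha
  · rw [map_zero]; exact zero_mem _
  · intro x y _ _ hx hy
    rw [map_add]; exact add_mem hx hy
  · intro c x hx' hx
    rw [smul_eq_mul, Derivation.leibniz, smul_eq_mul, smul_eq_mul]
    refine add_mem (Ideal.mul_mem_left _ _ hx) (Ideal.mul_mem_right _ _ ?_)
    exact Ideal.map_mono (le_derivIdeal k I) hx'

/-- **`𝒟ⁱ` commutes with formally étale base change**: `𝒟ⁱ(I·B) = 𝒟ⁱ(I)·B` for `B` formally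
étale over `A` and `Ω[A⁄k]` finitely generated projective.
[cite: BierstoneGrigorievMilmanWlodarczyk2011, Lemma 3.9.5 (1)] -/
theorem derivIdealIter_map_of_formallyEtale [Module.Projective A Ω[A⁄k]] [Module.Finite A Ω[A⁄k]]
    [Algebra A B] [IsScalarTower k A B] [Algebra.FormallyEtale A B] (i : ℕ) (I : Ideal A) :
    derivIdealIter k i (I.map (algebraMap A B)) = (derivIdealIter k i I).map (algebraMap A B) := by
  refine le_antisymm ?_ (map_derivIdealIter_le_of_formallyEtale k i I)
  induction i with
  | zero => exact le_rfl
  | succ i ih =>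
    rw [derivIdealIter_succ, derivIdealIter_succ]
    refine (derivIdeal_mono k ih).trans ?_
    exact derivIdeal_map_le_map_derivIdeal (IsScalarTower.toAlgHom k A B) (derivIdealIter k i I)

end Reverse

/-! ## Sheaf level: `ψ^*𝒟ⁱ(𝓘) = 𝒟ⁱ(ψ^*𝓘)` for étale `ψ` and projective differentials on `X` -/

section SheafEq

variable {k : Type v} [CommRing k] {U X : Scheme.{u}} (ψ : U ⟶ X) (φ : k →+* Γ(X, ⊤))

/-- **BGMW Lemma 3.9.5 (1): `ψ^*𝒟ⁱ(𝓘) = 𝒟ⁱ(ψ^*𝓘)` for an étale morphism `ψ : U → X`**, for a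
`k`-structure `φ` on `X` with finitely presented differentials on `X` and on `U` (induced
structure) and projective differentials on the affine pieces of `X` (e.g. `X` smooth over the
field `k`). [cite: BierstoneGrigorievMilmanWlodarczyk2011, Lemma 3.9.5 (1)] -/
theorem derivIdealSheafIter_comap_of_etale [Etale ψ] (hX : HasFinitePresentationDifferentials φ)
    (hU : HasFinitePresentationDifferentials (ψ.appTop.hom.comp φ))
    (hproj : ∀ V : X.affineOpens,
      letI := sectionsAlgebra φ V; Module.Projective Γ(X, V) Ω[Γ(X, V)⁄k])
    (i : ℕ) (I : X.IdealSheafData) :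
    (derivIdealSheafIter φ i I).comap ψ = derivIdealSheafIter (ψ.appTop.hom.comp φ) i (I.comap ψ) := by
  refine le_antisymm (comap_derivIdealSheafIter_le_of_etale ψ φ hX hU i I) ?_
  -- affine charts `W x → V x`
  have hch : ∀ x : U, ∃ (V : X.affineOpens) (W : U.affineOpens),
      x ∈ (W : U.Opens) ∧ (W : U.Opens) ≤ ψ ⁻¹ᵁ (V : X.Opens) := by
    intro x
    obtain ⟨V, hV, hxV, -⟩ :=
      exists_isAffineOpen_mem_and_subset (X := X) (x := ψ x) (U := ⊤) (Opens.mem_top _)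
    obtain ⟨W, hW, hxW, hWV⟩ :=
      exists_isAffineOpen_mem_and_subset (X := U) (x := x) (U := ψ ⁻¹ᵁ V) hxV
    exact ⟨⟨V, hV⟩, ⟨W, hW⟩, hxW, hWV⟩
  choose V W hxW hWV using hch
  have hcov : ⨆ x, (W x : U.Opens) = ⊤ :=
    top_le_iff.mp fun x _ => Opens.mem_iSup.mpr ⟨x, hxW x⟩
  refine Scheme.IdealSheafData.le_of_iSup_eq_top W hcov fun x => ?_
  letI := sectionsAlgebra φ (V x)
  letI := sectionsAlgebra (ψ.appTop.hom.comp φ) (W x)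
  letI alg : Algebra Γ(X, V x) Γ(U, W x) := (ψ.appLE (V x) (W x) (hWV x)).hom.toAlgebra
  haveI : IsScalarTower k Γ(X, V x) Γ(U, W x) :=
    IsScalarTower.of_algebraMap_eq' (appLE_comp_sectionsHom φ ψ (V x) (W x) (hWV x)).symm
  haveI : Algebra.Etale Γ(X, V x) Γ(U, W x) :=
    HasRingHomProperty.appLE @Etale ψ inferInstance (V x) (W x) (hWV x)
  haveI : Module.Projective Γ(X, V x) Ω[Γ(X, V x)⁄k] := hproj (V x)
  haveI : Module.FinitePresentation Γ(X, V x) Ω[Γ(X, V x)⁄k] := hX (V x)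
  rw [ideal_comap_of_le ψ _ (V x) (W x) (hWV x), derivIdealSheafIter_ideal hX,
    derivIdealSheafIter_ideal hU, ideal_comap_of_le ψ _ (V x) (W x) (hWV x)]
  exact (derivIdealIter_map_of_formallyEtale (k := k) i (I.ideal (V x))).le

end SheafEq

/-! ## Over a field: smooth `X` -/

section Smooth

variable (k : Type u) [Field k] {X U : Scheme.{u}} [X.Over (Spec (.of k))]

/-- The affine pieces of a scheme smooth over a field have (finitely generated) projective
modules of differentials. [folklore] -/
theorem projective_kaehlerDifferential_sections_of_smooth [Smooth (X ↘ Spec (.of k))]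
    (V : X.affineOpens) :
    letI := sectionsAlgebra (overHom k X) V; Module.Projective Γ(X, V) Ω[Γ(X, V)⁄k] := by
  letI := sectionsAlgebra (overHom k X) V
  have h : (sectionsHom (overHom k X) V).Smooth := smooth_sectionsHom_overHom k X V
  haveI : Algebra.Smooth k Γ(X, V) := h
  infer_instance

/-- **`ψ^*𝒟ⁱ(𝓘) = 𝒟ⁱ(ψ^*𝓘)` for an étale morphism into a scheme smooth over a field** (with the
`k`-structure `overHom` and the induced one on `U`).
[cite: BierstoneGrigorievMilmanWlodarczyk2011, Lemma 3.9.5 (1)] -/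
theorem derivIdealSheafIter_comap_of_etale_of_smooth [Smooth (X ↘ Spec (.of k))]
    (ψ : U ⟶ X) [Etale ψ] (i : ℕ) (I : X.IdealSheafData) :
    (derivIdealSheafIter (overHom k X) i I).comap ψ =
      derivIdealSheafIter (ψ.appTop.hom.comp (overHom k X)) i (I.comap ψ) := by
  have hX : HasFinitePresentationDifferentials (overHom k X) := by
    have h := hasFinitePresentationDifferentials_appTop_comp_overHom k (𝟙 X)
    rwa [id_appTop_comp] at h
  exact derivIdealSheafIter_comap_of_etale ψ (overHom k X) hX
    (hasFinitePresentationDifferentials_appTop_comp_overHom k ψ)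
    (projective_kaehlerDifferential_sections_of_smooth k) i I

end Smooth

end Literature.AlgebraicGeometry.Resolution

end
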